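import Literature.AnabelianGeometry.EtaleTheta.Discharge.Sec4Prop42SubFaithfulArith
import Literature.AnabelianGeometry.EtaleTheta.Discharge.Sec4Prop42SubUnitRoots
import HarnessLib

/-!
# [EtTh] Prop. 4.2 (iii) and Prop. 4.2 (iv) SEPARATELY at the faithful [FrdII] Def. 2.2 (ii) saturation slot over
# `B^temp(Π^tp_X)⁰` — node-level closers with the idle binders of the joint floor removed

S. Mochizuki, *The étale theta function and its Frobenioid-theoretic manifestations*, Publ. RIMS **45** (2009)
[MochizukiEtTh2009], §4, Prop. 4.2 (iii) PDF p.88 l.24 – p.88 l.70 (printed p.314), Prop. 4.2 (iv) PDF p.88 l.71 – p.89 l.60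
(printed pp.314–315), proof PDF p.89 l.77 – p.90 l.25 [cite: MochizukiEtTh2009, Prop 4.2 p.88]; [FrdII] Rmk. 2.2.1 p.18.

abc-iut cell, layer L2, DAG nodes `EtTh:Prop4.2(iii)` / `EtTh:Prop4.2(iv)` («COUNT CENSUS» key of abc-iut-L2-lead R953);
seat abc-iut-w6-d037 (gen 5).  PROOF-ONLY (0 `def`s, 0 instances; nothing landed is edited or restated).

WHY.  The closers of record at print's genuine connected base with the `(N, H_⊙^{bs-fld})`-saturation slot of Def. 4.1
(iii)(a) instantiated FAITHFULLY by [FrdII] Def. 2.2 (ii) (abc-iut-w4-d044's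
`Prop42Sub.prop42_iii_iv_mkOfConnectedTemperoid_faithful`, p466882, and its `treeCatVocab` corollaries p467290) prove the
CONJUNCTION (iii) ∧ (iv) from {`Φ` divisorial, `hDSpull` ([FrdI] Prop. 4.1 (iii), GAP G-w5d063-1), `hR` (ERRATUM E2 root law,
GAP G-w4d044-3), `hex`, `h221` ([FrdII] Rmk. 2.2.1 ×2 at the instance)} ∪ {B2 data `haug`/`act`/`hact`}, and the two
node-level projections `prop42_iii_…_faithful_treeCatVocab` / `prop42_iv_…_faithful_treeCatVocab` inherit ALL of these binders
through `include`.  But print's proof uses them node by node: (iii) (existence of an `N`-th root, p.89 l.77 – p.90 l.11) uses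
the root law, the coprimality pull-back and the EXISTENCE of saturated pull-backs («[Mzk18], Remark 2.2.1 [concerning the issue
of (N,H)-saturation]», p.90 l.10–11) — never the roots-of-invariants clause; (iv) (uniqueness up to `μ_N`, p.90 l.12–25) uses
ONLY «it follows from the (N, H_⊙, f|_{A_N})-saturated-ness condition … that the pull-back … of any element of `O^×(A_⊙)` admits
an `N`-th root» (p.90 l.13–16 = [FrdII] Rmk. 2.2.1 = `h221`) plus [FrdI] bookkeeping — never `hR`, `hDSpull`, `hex`.
This file records exactly that, BY NAME (one-line compositions of landed theorems):
* `Prop42Sub.prop42_iii_mkOfConnectedTemperoid_faithful_of_hex` — (iii) ⟸ {`Φ` divisorial, `hDSpull`, `hR`, `hex`} ∪ data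
  (abc-iut-w6-d037's `prop42_iii_mkOfConnectedTemperoid_of_laws` with `hE := refinementLaw_of_def22Ctx … hex`);
* `Prop42Sub.prop42_iv_mkOfConnectedTemperoid_faithful_of_h221` — (iv) ⟸ {`Φ` divisorial, `h221`} ∪ data
  (abc-iut-w4-d044's `prop42_iv_mkOfModelCanonical_of_constantRoots` with
  `hL := constantRoots_…_of_invariantUnitRoots (invariantUnitRoots_of_def22Ctx … h221)`);
* over abc-iut-L1's canonical base-category vocabulary `treeCatVocab` («`Φ` divisorial» = the Def. 3.6 (ii) FIELD):
  `prop42_iii_mkOfConnectedTemperoid_faithful_treeCatVocab_of_hex` ⟸ {`hDSpull`, `hR`, `hex`} ∪ data and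
  `prop42_iv_mkOfConnectedTemperoid_faithful_treeCatVocab_of_h221` ⟸ {`h221`} ∪ data — the NODE FLOORS;
* `Prop42Sub.prop42_iv_mkOfConnectedTemperoid_faithful_of_arith` — (iv) ⟸ {`Φ` divisorial, `harith`} ∪ data, the F-1198
  input entering as abc-iut-L1-t7's THEOREM at `ofLocalField` (abc-iut-w4-d044's `h221_of_arith`, p467903).
So, per node: `EtTh:Prop4.2(iv)` carries ONE print-cited clause ([FrdII] Rmk. 2.2.1, FACT row F-1198 instance form / its
arithmetic binding) and NO GAP law; `EtTh:Prop4.2(iii)` carries the two GAP laws G-w5d063-1 / G-w4d044-3 (theorems at every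
constructed tempered Frobenioid of record resp. at the Kummer–Tate tower datum; not properties of the typed structure) and
the Rmk. 2.2.1 existence clause.  HONEST FRAMING: [EtTh]/[FrdI]/[FrdII] are refereed prerequisite papers; the binders are
print's own (cited) hypotheses BY NAME, typed ≠ proved for them; nothing here bears on, or takes a side on, the disputed
[IUTchIII] Cor. 3.12; nothing here asserts abc proved or refuted.
-/

noncomputable section

namespace Literature.AnabelianGeometry.EtaleTheta

open CategoryTheory Opposite Literature.AlgebraicGeometry.Frobenioids Literature.AnabelianGeometry.SemiGraphs
  Literature.AlgebraicGeometry.Frobenioids.QuasiTemperoid.BTempConnected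
open Literature.NumberTheory.GaloisRepresentations.LocalWeilDatum (galFixing)

namespace BiKummerSetting

/-! ## §1 Any base-category vocabulary `VD` («`Φ` divisorial» a binder) -/

section FaithfulNodes

variable {K : Type} [Field K] (X : SemiGraphs.TemperedArithmeticGroup.{0} K) {D₀ : Type} [Category.{0} D₀]
  {V : FrdIMonoidStub.{0}} {T₀ : RealifiedDivisorMonoids (D₀ := D₀) V}
  {VD : FrdICatStub.{1, 0, 0} (ConnectedPart (BTemp X.Pi))}
  (tf : TemperedFrobenioid T₀ (ConnectedPart (BTemp X.Pi)) VD) (hZ : tf.monoidType = MonoidType.Z)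
  (hP : ∀ A : (ConnectedPart (BTemp X.Pi))ᵒᵖ, IsPerfect (tf.Φ.carrier A))
  (haug : IsOpenMap X.aug)
  (act : ∀ A : tf.category, MulDistribMulAction (Aut (TemperedFrobenioid.AE X tf haug A)) ↥(tf.units A))
  (hact : ∀ (A : tf.category) (α : Aut A) (u : ↥(tf.units A)), (TemperedFrobenioid.resE X tf haug A α) • u =
    (⟨α * u.1 * α⁻¹, (tf.units_normal A).conj_mem _ u.2 α⟩ : ↥(tf.units A)))
  (A₀ : tf.category) (hA₀ : PreFrobenioid.IsFrobeniusTrivial tf.toElem A₀) (hA₀' : SemiGraphs.IsGaloisObj A₀.base.obj)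

/-- **DAG node `EtTh:Prop4.2(iii)` AS TYPED over `B^temp(Π^tp_X)⁰` at the FAITHFUL [FrdII] Def. 2.2 (ii) saturation slot,
node-sharp**: ⟸ {`Φ` divisorial, `hDSpull` ([FrdI] Prop. 4.1 (iii), G-w5d063-1), `hR` (ERRATUM E2 root law, G-w4d044-3),
`hex` ([FrdII] Rmk. 2.2.1: saturated pull-backs exist, read in `C`)} ∪ {B2 data `haug`/`act`/`hact`} — the roots-of-invariants
clause `h221` is NOT used for (iii). [cite: MochizukiEtTh2009, Prop 4.2 (iii) p.88] -/
theorem Prop42Sub.prop42_iii_mkOfConnectedTemperoid_faithful_of_hex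
    (hΦd : Objectwise (fun M _ => IsDivisorial M) tf.divisorMonoid)
    (hDSpull : ∀ {A A' : ConnectedPart (BTemp X.Pi)} (e : A' ⟶ A) {a b : tf.Φ.carrier (op A)},
      (∀ x : tf.Φ.carrier (op A), x ∣ a → x ∣ b → x = 1) →
        ∀ y : tf.Φ.carrier (op A'), y ∣ pull tf.divisorMonoid e a → y ∣ pull tf.divisorMonoid e b → y = 1)
    (hR : ∀ (N : ℕ+) (A : ConnectedPart (BTemp X.Pi)), SemiGraphs.IsGaloisObj A.obj →
      ∀ f : tf.ratFnFunctor.obj (op A),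
        ∃ (A' : ConnectedPart (BTemp X.Pi)) (_ : SemiGraphs.IsGaloisObj A'.obj) (b : A' ⟶ A)
          (g : tf.ratFnFunctor.obj (op A')), g ^ (N : ℕ) = pull tf.ratFnFunctor b f)
    (hex : ∀ (A' : tf.category) (N : ℕ+), ∃ (A'' : tf.category) (ψ : A'' ⟶ A'),
      PreFrobenioid.IsPullbackMorphism tf.toElem ψ ∧
        PadicKummer.IsNHSaturated (TemperedFrobenioid.def22Ctx X tf haug A'' (act A'') (hact A'')
          (mkOfConnectedTemperoid X tf hZ hP (fun H A N => ∃ (hn : H.Normal)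
              (ho : IsOpen (H : Set (Field.absoluteGaloisGroup K))),
              PadicKummer.IsNHSaturated (TemperedFrobenioid.def22Ctx X tf haug A (act A) (hact A) H hn ho) N)
            A₀ hA₀ hA₀').HodotBsFld
          (mkOfConnectedTemperoid X tf hZ hP (fun _ _ _ => True) A₀ hA₀ hA₀').hodotBsFld_normal
          ((mkOfConnectedTemperoid X tf hZ hP (fun _ _ _ => True) A₀ hA₀ hA₀').isOpen_hodotBsFld_of_isOpenMap
            (isOpen_Hodot_mkOfConnectedTemperoid X tf hZ hP _ A₀ hA₀ hA₀') haug)) N) :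
    (mkOfConnectedTemperoid X tf hZ hP (fun H A N => ∃ (hn : H.Normal)
          (ho : IsOpen (H : Set (Field.absoluteGaloisGroup K))),
          PadicKummer.IsNHSaturated (TemperedFrobenioid.def22Ctx X tf haug A (act A) (hact A) H hn ho) N)
        A₀ hA₀ hA₀').Prop42_iii (fun {_ _} φ x => tf.pullFracModel φ x) :=
  Prop42Sub.prop42_iii_mkOfConnectedTemperoid_of_laws X tf hZ hP _ A₀ hA₀ hA₀' hΦd hDSpull hR
    (Prop42Sub.refinementLaw_of_def22Ctx (hZ := hZ) (hP := hP) (A₀ := A₀) (hA₀ := hA₀) (hA₀' := hA₀')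
      haug act hact _ _ (fun _ _ h => ⟨_, _, h⟩) hex)

/-- **DAG node `EtTh:Prop4.2(iv)` AS TYPED over `B^temp(Π^tp_X)⁰` at the FAITHFUL [FrdII] Def. 2.2 (ii) saturation slot,
node-sharp**: ⟸ {`Φ` divisorial, `h221` ([FrdII] Rmk. 2.2.1 «any `f ∈ O^□(A)^H` admits an `N`-th root» for the
Frobenius-trivial `A″` over `A_⊙`, FACT row F-1198 AT THE INSTANCE)} ∪ {B2 data `haug`/`act`/`hact`} — NO root law `hR`, NO
coprimality law `hDSpull`, NO existence clause `hex`: print's uniqueness argument (p.90 l.12–25) does not use them.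
[cite: MochizukiEtTh2009, Prop 4.2 (iv) p.89] -/
theorem Prop42Sub.prop42_iv_mkOfConnectedTemperoid_faithful_of_h221
    (hΦd : Objectwise (fun M _ => IsDivisorial M) tf.divisorMonoid)
    (h221 : ∀ (A'' : tf.category) (N : ℕ+), (A''.base ⟶ A₀.base) → PreFrobenioid.IsFrobeniusTrivial tf.toElem A'' →
      PadicKummer.SaturatedInvariantsAdmitRoots (TemperedFrobenioid.def22Ctx X tf haug A'' (act A'') (hact A'')
          (mkOfConnectedTemperoid X tf hZ hP (fun H A N => ∃ (hn : H.Normal)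
              (ho : IsOpen (H : Set (Field.absoluteGaloisGroup K))),
              PadicKummer.IsNHSaturated (TemperedFrobenioid.def22Ctx X tf haug A (act A) (hact A) H hn ho) N)
            A₀ hA₀ hA₀').HodotBsFld
          (mkOfConnectedTemperoid X tf hZ hP (fun _ _ _ => True) A₀ hA₀ hA₀').hodotBsFld_normal
          ((mkOfConnectedTemperoid X tf hZ hP (fun _ _ _ => True) A₀ hA₀ hA₀').isOpen_hodotBsFld_of_isOpenMap
            (isOpen_Hodot_mkOfConnectedTemperoid X tf hZ hP _ A₀ hA₀ hA₀') haug)) N) :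
    (mkOfConnectedTemperoid X tf hZ hP (fun H A N => ∃ (hn : H.Normal)
          (ho : IsOpen (H : Set (Field.absoluteGaloisGroup K))),
          PadicKummer.IsNHSaturated (TemperedFrobenioid.def22Ctx X tf haug A (act A) (hact A) H hn ho) N)
        A₀ hA₀ hA₀').Prop42_iv (fun φ x => tf.pullFracModel φ x) :=
  prop42_iv_mkOfModelCanonical_of_constantRoots X tf hZ hP _ _ _ _ A₀ hA₀ hA₀' hΦd
    (Prop42Sub.constantRoots_mkOfConnectedTemperoid_of_invariantUnitRoots X tf hZ hP _ A₀ hA₀ hA₀' hΦd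
      (Prop42Sub.invariantUnitRoots_of_def22Ctx X tf hZ hP haug act hact _ A₀ hA₀ hA₀' _ _ (fun _ _ _ h => h) h221))

end FaithfulNodes

/-! ## §2 Over the canonical base-category vocabulary `treeCatVocab`: the node floors -/

section FaithfulNodesTreeCat

variable {K : Type} [Field K] (X : SemiGraphs.TemperedArithmeticGroup.{0} K) {D₀ : Type} [Category.{0} D₀]
  {V : FrdIMonoidStub.{0}} {T₀ : RealifiedDivisorMonoids (D₀ := D₀) V}
  {IsRational IsStrictlyRational : ((ConnectedPart (BTemp X.Pi))ᵒᵖ ⥤ CommMonCat.{0}) → Prop}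
  (tf : TemperedFrobenioid T₀ (ConnectedPart (BTemp X.Pi))
    (treeCatVocab (ConnectedPart (BTemp X.Pi)) IsRational IsStrictlyRational))
  (hZ : tf.monoidType = MonoidType.Z) (hP : ∀ A : (ConnectedPart (BTemp X.Pi))ᵒᵖ, IsPerfect (tf.Φ.carrier A))
  (haug : IsOpenMap X.aug)
  (act : ∀ A : tf.category, MulDistribMulAction (Aut (TemperedFrobenioid.AE X tf haug A)) ↥(tf.units A))
  (hact : ∀ (A : tf.category) (α : Aut A) (u : ↥(tf.units A)), (TemperedFrobenioid.resE X tf haug A α) • u =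
    (⟨α * u.1 * α⁻¹, (tf.units_normal A).conj_mem _ u.2 α⟩ : ↥(tf.units A)))
  (A₀ : tf.category) (hA₀ : PreFrobenioid.IsFrobeniusTrivial tf.toElem A₀) (hA₀' : SemiGraphs.IsGaloisObj A₀.base.obj)

/-- **NODE FLOOR `EtTh:Prop4.2(iii)`** over `B^temp(Π^tp_X)⁰` / `treeCatVocab` at the faithful saturation slot: ⟸ {`hDSpull`
(G-w5d063-1), `hR` (G-w4d044-3), `hex` ([FrdII] Rmk. 2.2.1 existence)} ∪ {B2 data} — «`Φ` divisorial» is the Def. 3.6 (ii)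
field. [cite: MochizukiEtTh2009, Prop 4.2 (iii) p.88] -/
theorem prop42_iii_mkOfConnectedTemperoid_faithful_treeCatVocab_of_hex
    (hDSpull : ∀ {A A' : ConnectedPart (BTemp X.Pi)} (e : A' ⟶ A) {a b : tf.Φ.carrier (op A)},
      (∀ x : tf.Φ.carrier (op A), x ∣ a → x ∣ b → x = 1) →
        ∀ y : tf.Φ.carrier (op A'), y ∣ pull tf.divisorMonoid e a → y ∣ pull tf.divisorMonoid e b → y = 1)
    (hR : ∀ (N : ℕ+) (A : ConnectedPart (BTemp X.Pi)), SemiGraphs.IsGaloisObj A.obj →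
      ∀ f : tf.ratFnFunctor.obj (op A),
        ∃ (A' : ConnectedPart (BTemp X.Pi)) (_ : SemiGraphs.IsGaloisObj A'.obj) (b : A' ⟶ A)
          (g : tf.ratFnFunctor.obj (op A')), g ^ (N : ℕ) = pull tf.ratFnFunctor b f)
    (hex : ∀ (A' : tf.category) (N : ℕ+), ∃ (A'' : tf.category) (ψ : A'' ⟶ A'),
      PreFrobenioid.IsPullbackMorphism tf.toElem ψ ∧
        PadicKummer.IsNHSaturated (TemperedFrobenioid.def22Ctx X tf haug A'' (act A'') (hact A'')
          (mkOfConnectedTemperoid X tf hZ hP (fun H A N => ∃ (hn : H.Normal)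
              (ho : IsOpen (H : Set (Field.absoluteGaloisGroup K))),
              PadicKummer.IsNHSaturated (TemperedFrobenioid.def22Ctx X tf haug A (act A) (hact A) H hn ho) N)
            A₀ hA₀ hA₀').HodotBsFld
          (mkOfConnectedTemperoid X tf hZ hP (fun _ _ _ => True) A₀ hA₀ hA₀').hodotBsFld_normal
          ((mkOfConnectedTemperoid X tf hZ hP (fun _ _ _ => True) A₀ hA₀ hA₀').isOpen_hodotBsFld_of_isOpenMap
            (isOpen_Hodot_mkOfConnectedTemperoid X tf hZ hP _ A₀ hA₀ hA₀') haug)) N) :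
    (mkOfConnectedTemperoid X tf hZ hP (fun H A N => ∃ (hn : H.Normal)
          (ho : IsOpen (H : Set (Field.absoluteGaloisGroup K))),
          PadicKummer.IsNHSaturated (TemperedFrobenioid.def22Ctx X tf haug A (act A) (hact A) H hn ho) N)
        A₀ hA₀ hA₀').Prop42_iii (fun {_ _} φ x => tf.pullFracModel φ x) :=
  Prop42Sub.prop42_iii_mkOfConnectedTemperoid_faithful_of_hex X tf hZ hP haug act hact A₀ hA₀ hA₀'
    tf.isDivisorial_divisorMonoid hDSpull hR hex

/-- **NODE FLOOR `EtTh:Prop4.2(iv)`** over `B^temp(Π^tp_X)⁰` / `treeCatVocab` at the faithful saturation slot: ⟸ {`h221`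
([FrdII] Rmk. 2.2.1 for the Frobenius-trivial `A″` over `A_⊙`, F-1198 AT THE INSTANCE)} ∪ {B2 data} — NO GAP law.
[cite: MochizukiEtTh2009, Prop 4.2 (iv) p.89] -/
theorem prop42_iv_mkOfConnectedTemperoid_faithful_treeCatVocab_of_h221
    (h221 : ∀ (A'' : tf.category) (N : ℕ+), (A''.base ⟶ A₀.base) → PreFrobenioid.IsFrobeniusTrivial tf.toElem A'' →
      PadicKummer.SaturatedInvariantsAdmitRoots (TemperedFrobenioid.def22Ctx X tf haug A'' (act A'') (hact A'')
          (mkOfConnectedTemperoid X tf hZ hP (fun H A N => ∃ (hn : H.Normal)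
              (ho : IsOpen (H : Set (Field.absoluteGaloisGroup K))),
              PadicKummer.IsNHSaturated (TemperedFrobenioid.def22Ctx X tf haug A (act A) (hact A) H hn ho) N)
            A₀ hA₀ hA₀').HodotBsFld
          (mkOfConnectedTemperoid X tf hZ hP (fun _ _ _ => True) A₀ hA₀ hA₀').hodotBsFld_normal
          ((mkOfConnectedTemperoid X tf hZ hP (fun _ _ _ => True) A₀ hA₀ hA₀').isOpen_hodotBsFld_of_isOpenMap
            (isOpen_Hodot_mkOfConnectedTemperoid X tf hZ hP _ A₀ hA₀ hA₀') haug)) N) :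
    (mkOfConnectedTemperoid X tf hZ hP (fun H A N => ∃ (hn : H.Normal)
          (ho : IsOpen (H : Set (Field.absoluteGaloisGroup K))),
          PadicKummer.IsNHSaturated (TemperedFrobenioid.def22Ctx X tf haug A (act A) (hact A) H hn ho) N)
        A₀ hA₀ hA₀').Prop42_iv (fun φ x => tf.pullFracModel φ x) :=
  Prop42Sub.prop42_iv_mkOfConnectedTemperoid_faithful_of_h221 X tf hZ hP haug act hact A₀ hA₀ hA₀'
    tf.isDivisorial_divisorMonoid h221

end FaithfulNodesTreeCat

/-! ## §3 Node `EtTh:Prop4.2(iv)` with the ARITHMETIC BINDING in place of the F-1198 instance -/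

section FaithfulNodesArith

variable {K : Type} [Field K] [ValuativeRel K] [CharZero K] (X : SemiGraphs.TemperedArithmeticGroup.{0} K) {D₀ : Type}
  [Category.{0} D₀] {V : FrdIMonoidStub.{0}} {T₀ : RealifiedDivisorMonoids (D₀ := D₀) V}
  {VD : FrdICatStub.{1, 0, 0} (ConnectedPart (BTemp X.Pi))}
  (tf : TemperedFrobenioid T₀ (ConnectedPart (BTemp X.Pi)) VD) (hZ : tf.monoidType = MonoidType.Z)
  (hP : ∀ A : (ConnectedPart (BTemp X.Pi))ᵒᵖ, IsPerfect (tf.Φ.carrier A))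
  (haug : IsOpenMap X.aug)
  (act : ∀ A : tf.category, MulDistribMulAction (Aut (TemperedFrobenioid.AE X tf haug A)) ↥(tf.units A))
  (hact : ∀ (A : tf.category) (α : Aut A) (u : ↥(tf.units A)), (TemperedFrobenioid.resE X tf haug A α) • u =
    (⟨α * u.1 * α⁻¹, (tf.units_normal A).conj_mem _ u.2 α⟩ : ↥(tf.units A)))
  (A₀ : tf.category) (hA₀ : PreFrobenioid.IsFrobeniusTrivial tf.toElem A₀) (hA₀' : SemiGraphs.IsGaloisObj A₀.base.obj)
  (fs : Prop)

/-- **DAG node `EtTh:Prop4.2(iv)` AS TYPED over `B^temp(Π^tp_X)⁰` at the faithful slot, WITH THE ARITHMETIC BINDING**: ⟸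
{`Φ` divisorial, `harith` («`A_E = Spec(L)`», `Gal(K̄/L) ≤ H_⊙^{bs-fld}`)} ∪ {B2 data} — the [FrdII] Rmk. 2.2.1 root input enters
as abc-iut-L1-t7's THEOREM at `ofLocalField` (abc-iut-w4-d044's `h221_of_arith`); no binder is headed by a refuted-closure FACT
row, no GAP law. [cite: MochizukiEtTh2009, Prop 4.2 (iv) p.89] -/
theorem Prop42Sub.prop42_iv_mkOfConnectedTemperoid_faithful_of_arith
    (hΦd : Objectwise (fun M _ => IsDivisorial M) tf.divisorMonoid)
    (harith : ∀ (A'' : tf.category), (A''.base ⟶ A₀.base) → PreFrobenioid.IsFrobeniusTrivial tf.toElem A'' →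
      ∃ (L : IntermediateField K (AlgebraicClosure K)) (hfd : FiniteDimensional K L) (hn : Normal K L),
        galFixing K L ≤ (mkOfConnectedTemperoid X tf hZ hP (fun _ _ _ => True) A₀ hA₀ hA₀').HodotBsFld ∧
        Nonempty (PadicKummer.Def22Context.Iso
          (TemperedFrobenioid.def22Ctx X tf haug A'' (act A'') (hact A'')
            (mkOfConnectedTemperoid X tf hZ hP (fun _ _ _ => True) A₀ hA₀ hA₀').HodotBsFld
            (mkOfConnectedTemperoid X tf hZ hP (fun _ _ _ => True) A₀ hA₀ hA₀').hodotBsFld_normal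
            ((mkOfConnectedTemperoid X tf hZ hP (fun _ _ _ => True) A₀ hA₀ hA₀').isOpen_hodotBsFld_of_isOpenMap
              (isOpen_Hodot_mkOfConnectedTemperoid X tf hZ hP _ A₀ hA₀ hA₀') haug))
          (@PadicKummer.Def22Context.ofLocalField K _ L hn hfd
            (mkOfConnectedTemperoid X tf hZ hP (fun _ _ _ => True) A₀ hA₀ hA₀').HodotBsFld
            (mkOfConnectedTemperoid X tf hZ hP (fun _ _ _ => True) A₀ hA₀ hA₀').hodotBsFld_normal
            ((mkOfConnectedTemperoid X tf hZ hP (fun _ _ _ => True) A₀ hA₀ hA₀').isOpen_hodotBsFld_of_isOpenMap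
              (isOpen_Hodot_mkOfConnectedTemperoid X tf hZ hP _ A₀ hA₀ hA₀') haug)
            (PadicKummer.boxStableSubmonoid K L fs)))) :
    (mkOfConnectedTemperoid X tf hZ hP (fun H A N => ∃ (hn : H.Normal)
          (ho : IsOpen (H : Set (Field.absoluteGaloisGroup K))),
          PadicKummer.IsNHSaturated (TemperedFrobenioid.def22Ctx X tf haug A (act A) (hact A) H hn ho) N)
        A₀ hA₀ hA₀').Prop42_iv (fun φ x => tf.pullFracModel φ x) :=
  Prop42Sub.prop42_iv_mkOfConnectedTemperoid_faithful_of_h221 X tf hZ hP haug act hact A₀ hA₀ hA₀' hΦd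
    (Prop42Sub.h221_of_arith X tf hZ hP haug act hact A₀ hA₀ hA₀' fs harith)

end FaithfulNodesArith

end BiKummerSetting

end Literature.AnabelianGeometry.EtaleTheta

end
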